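import Literature.Combinatorics.SimpleGraph.LiftIndependence
import Literature.ModelTheory.FiniteModelTheory.CohomologicalConsistencyThreeColouringProofs
import HarnessLib

/-!
# Local sparsity of random lifts: the first-moment count

Topic `Literature/Combinatorics/SimpleGraph`.  For the random-graph input of Conneryd–Ghannane–
Pang 2025, Theorem 6.1 (sparsity of the fooling graphs, Lemma 6.4 of the source for `𝒢_{n,d}`)
we count, over all lifts `π : UpEdge B → Perm (Fin a)` of a fixed base graph `B`
(`GraphLifts.lean`), the pairs (lift, dense small vertex set):

* `PotEdge B a` — POTENTIAL EDGES `(e, i, j)`: "`π e i = j`", i.e. the pair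
  `{(e.lo, i), (e.hi, j)}`; `PotEdge.inside U` — those with both endpoints in `U`
  (`card_inside_le : # ≤ |U|²`); `constrained F` — the lifts realising every potential edge of `F`;
* `exists_constrained_of_le_card_edgesIn` — if `U` spans `≥ j` edges of `liftGraph π` then
  `π ∈ constrained F` for some `F ⊆ inside U` with `|F| = j`;
* `card_constrained_mul_le` — `#constrained F · (a - j)^j ≤ (a!)^{|E|}` for `|F| = j ≤ a`
  (`card_permsPrescribed`; an inconsistent `F` constrains nothing... i.e. everything: `∅`);
* **`card_dense_mul_le`** — `#{π | ∃ U, |U| = u, e_π(U) ≥ j} · (a - j)^j ≤ C(|W|a, u) · C(u², j) · (a!)^{|E|}`.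

## References

* [ConnerydGhannanePang2025] arXiv:2511.17272, Def. 6.3 / Lemma 6.4 (the property needed).
* [folklore] first-moment method for the local density of random regular graphs / lifts.
-/

noncomputable section

namespace Literature.Combinatorics.SimpleGraph

open Finset Literature.Combinatorics.Enumerative
open Literature.ModelTheory.FiniteModelTheory.ConnerydGhannanePang (edgesIn mem_edgesIn)

variable {W : Type*} [LinearOrder W] {B : _root_.SimpleGraph W} {a : ℕ}

/-! ### Potential edges -/

variable (B a) in
/-- POTENTIAL EDGES of a lift: `(e, i, j)` stands for "`π e i = j`", the pair
`{(e.lo, i), (e.hi, j)}`. [folklore] -/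
abbrev PotEdge : Type _ := (_ : UpEdge B) × (Fin a × Fin a)

/-- The pair of vertices of a potential edge. [folklore] -/
def PotEdge.toSym2 (τ : PotEdge B a) : Sym2 (W × Fin a) :=
  s((τ.1.lo, τ.2.1), (τ.1.hi, τ.2.2))

/-- Distinct potential edges give distinct pairs. [folklore] -/
theorem PotEdge.toSym2_injective : Function.Injective (PotEdge.toSym2 (B := B) (a := a)) := by
  rintro ⟨e, i, j⟩ ⟨e', i', j'⟩ h
  simp only [PotEdge.toSym2] at h
  rcases Sym2.eq_iff.1 h with ⟨h1, h2⟩ | ⟨h1, h2⟩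
  · obtain ⟨hlo, hi⟩ := Prod.mk.injEq _ _ _ _ ▸ h1
    obtain ⟨hhi, hj⟩ := Prod.mk.injEq _ _ _ _ ▸ h2
    have he : e = e' := UpEdge.ext' hlo hhi
    subst he; subst hi; subst hj; rfl
  · have hlo : e.lo = e'.hi := (Prod.mk.injEq _ _ _ _ ▸ h1).1
    have hhi : e.hi = e'.lo := (Prod.mk.injEq _ _ _ _ ▸ h2).1
    exact absurd (e.lo_lt_hi.trans (hhi ▸ e'.lo_lt_hi)) (hlo ▸ lt_irrefl _)

variable [Fintype W] [DecidableRel B.Adj]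

/-- The potential edges with both endpoints in `U`. [folklore] -/
def PotEdge.inside (U : Finset (W × Fin a)) : Finset (PotEdge B a) :=
  Finset.univ.filter fun τ => (τ.1.lo, τ.2.1) ∈ U ∧ (τ.1.hi, τ.2.2) ∈ U

/-- `#inside U ≤ |U|²`. [folklore] -/
theorem PotEdge.card_inside_le (U : Finset (W × Fin a)) :
    (PotEdge.inside (B := B) U).card ≤ U.card ^ 2 := by
  rw [sq, ← Finset.card_product]
  refine Finset.card_le_card_of_injOn (fun τ => ((τ.1.lo, τ.2.1), (τ.1.hi, τ.2.2)))
    (fun τ hτ => ?_) fun τ _ τ' _ h => ?_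
  · have h := (Finset.mem_filter.1 (Finset.mem_coe.1 hτ)).2
    exact Finset.mem_coe.2 (Finset.mem_product.2 h)
  · apply PotEdge.toSym2_injective
    simp only [PotEdge.toSym2]
    have h1 := congrArg Prod.fst h
    have h2 := congrArg Prod.snd h
    simp only at h1 h2
    rw [h1, h2]

/-- THE LIFTS REALISING every potential edge of `F`. [folklore] -/
def constrained (F : Finset (PotEdge B a)) : Finset (UpEdge B → Equiv.Perm (Fin a)) :=
  Finset.univ.filter fun π => ∀ τ ∈ F, π τ.1 τ.2.1 = τ.2.2

/-- Membership in `constrained`. [folklore] -/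
theorem mem_constrained {F : Finset (PotEdge B a)} {π : UpEdge B → Equiv.Perm (Fin a)} :
    π ∈ constrained F ↔ ∀ τ ∈ F, π τ.1 τ.2.1 = τ.2.2 := by
  simp [constrained]

/-! ### Dense sets are constrained -/

omit [Fintype W] [DecidableRel B.Adj] in
/-- Every edge of a lift is the pair of a potential edge realised by the lift. [folklore] -/
theorem exists_potEdge_of_mem_edgeSet (π : UpEdge B → Equiv.Perm (Fin a)) {s : Sym2 (W × Fin a)}
    (hs : s ∈ (liftGraph π).edgeSet) : ∃ τ : PotEdge B a, τ.toSym2 = s ∧ π τ.1 τ.2.1 = τ.2.2 := by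
  induction s using Sym2.ind with
  | h p q =>
    rw [_root_.SimpleGraph.mem_edgeSet] at hs
    obtain ⟨x, i⟩ := p
    obtain ⟨y, j⟩ := q
    rcases hs with ⟨hxy, hij⟩ | ⟨hyx, hji⟩
    · exact ⟨⟨UpEdge.mk' x y hxy, (i, j)⟩, by simp [PotEdge.toSym2], hij⟩
    · exact ⟨⟨UpEdge.mk' y x hyx, (j, i)⟩, by simp [PotEdge.toSym2, Sym2.eq_swap], hji⟩

/-- **Dense sets are constrained**: if `U` spans at least `j` edges of `liftGraph π` then
`π ∈ constrained F` for some `F ⊆ inside U` with `|F| = j`. [folklore] -/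
theorem exists_constrained_of_le_card_edgesIn (π : UpEdge B → Equiv.Perm (Fin a))
    (U : Finset (W × Fin a)) {j : ℕ} (hj : j ≤ (edgesIn (liftGraph π) U).card) :
    ∃ F ⊆ PotEdge.inside U, F.card = j ∧ π ∈ constrained F := by
  classical
  -- choose a potential edge under each edge
  have hch : ∀ s ∈ edgesIn (liftGraph π) U, ∃ τ : PotEdge B a, τ.toSym2 = s ∧ π τ.1 τ.2.1 = τ.2.2 :=
    fun s hs => exists_potEdge_of_mem_edgeSet π ((mem_edgesIn _).1 hs).1
  choose f hf hπf using hch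
  obtain ⟨E, hEsub, hEcard⟩ := Finset.exists_subset_card_eq hj
  refine ⟨E.attach.image fun s => f s.1 (hEsub s.2), fun τ hτ => ?_, ?_, ?_⟩
  · obtain ⟨s, -, rfl⟩ := Finset.mem_image.1 hτ
    have hs' := (mem_edgesIn _).1 (hEsub s.2)
    rw [PotEdge.inside, Finset.mem_filter]
    have h := hf s.1 (hEsub s.2)
    have hm1 : ((f s.1 (hEsub s.2)).1.lo, (f s.1 (hEsub s.2)).2.1) ∈ (f s.1 (hEsub s.2)).toSym2 :=
      Sym2.mem_mk_left _ _
    have hm2 : ((f s.1 (hEsub s.2)).1.hi, (f s.1 (hEsub s.2)).2.2) ∈ (f s.1 (hEsub s.2)).toSym2 :=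
      Sym2.mem_mk_right _ _
    rw [h] at hm1 hm2
    exact ⟨Finset.mem_univ _, hs'.2 _ hm1, hs'.2 _ hm2⟩
  · rw [Finset.card_image_of_injOn fun s _ s' _ h => Subtype.ext (by
      rw [← hf s.1 (hEsub s.2), ← hf s'.1 (hEsub s'.2)]; exact congrArg PotEdge.toSym2 h),
      Finset.card_attach, hEcard]
  · rw [mem_constrained]
    intro τ hτ
    obtain ⟨s, -, rfl⟩ := Finset.mem_image.1 hτ
    exact hπf s.1 (hEsub s.2)

/-! ### Counting constrained lifts -/

omit [Fintype W] [DecidableRel B.Adj] in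
/-- Permutations agreeing with ANY `f` on `S` number at most `(n - |S|)!` (exactly, if `f` is
injective on `S`; none otherwise). [folklore] -/
theorem card_permsPrescribed_le {α : Type*} [Fintype α] [DecidableEq α] (S : Finset α) (f : α → α) :
    (permsPrescribed S f).card ≤ (Fintype.card α - S.card).factorial := by
  by_cases hf : Set.InjOn f S
  · exact (card_permsPrescribed S hf).le
  · have : permsPrescribed S f = ∅ := by
      refine Finset.eq_empty_of_forall_notMem fun σ hσ => hf fun x hx y hy hxy => ?_
      rw [mem_permsPrescribed] at hσ
      rw [← hσ x hx, ← hσ y hy] at hxy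
      exact σ.injective hxy
    rw [this, Finset.card_empty]
    exact Nat.zero_le _

omit [Fintype W] [DecidableRel B.Adj] in
/-- `(a - m)! · (a - j)^m ≤ a!` for `m ≤ j ≤ a`. [folklore] -/
theorem factorial_sub_mul_pow_le {a j : ℕ} (hj : j ≤ a) : ∀ {m : ℕ}, m ≤ j →
    (a - m).factorial * (a - j) ^ m ≤ a.factorial
  | 0, _ => by simp
  | m + 1, hm => by
    have ih := factorial_sub_mul_pow_le hj (Nat.le_of_succ_le hm)
    have hstep : (a - (m + 1)).factorial * (a - j) ≤ (a - m).factorial := by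
      have h1 : a - m = (a - (m + 1)) + 1 := by omega
      rw [h1, Nat.factorial_succ, mul_comm ((a - (m + 1)) + 1)]
      exact Nat.mul_le_mul_left _ (by omega)
    calc (a - (m + 1)).factorial * (a - j) ^ (m + 1)
        = (a - (m + 1)).factorial * (a - j) * (a - j) ^ m := by ring
      _ ≤ (a - m).factorial * (a - j) ^ m := Nat.mul_le_mul_right _ hstep
      _ ≤ a.factorial := ih

/-- **Counting constrained lifts**: `#constrained F · (a - |F|)^{|F|} ≤ (a!)^{|E|}` when
`|F| ≤ a`. [folklore] -/
theorem card_constrained_mul_le (F : Finset (PotEdge B a)) (hF : F.card ≤ a) :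
    (constrained F).card * (a - F.card) ^ F.card ≤ a.factorial ^ Fintype.card (UpEdge B) := by
  classical
  -- an inconsistent `F` (two targets for the same `(e, i)`) constrains no lift
  by_cases hinc : ∃ τ ∈ F, ∃ τ' ∈ F, τ ≠ τ' ∧ τ.1 = τ'.1 ∧ τ.2.1 = τ'.2.1
  · obtain ⟨τ, hτ, τ', hτ', hne, h1, h2⟩ := hinc
    have : constrained F = ∅ := by
      refine Finset.eq_empty_of_forall_notMem fun π hπ => hne ?_
      rw [mem_constrained] at hπ
      have e1 := hπ τ hτ
      have e2 := hπ τ' hτ'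
      obtain ⟨e, i, j⟩ := τ
      obtain ⟨e', i', j'⟩ := τ'
      simp only at h1 h2 e1 e2
      subst h1; subst h2
      rw [e1] at e2
      subst e2; rfl
    rw [this, Finset.card_empty, zero_mul]; exact Nat.zero_le _
  push Not at hinc
  -- the constraint data at each upward edge
  let S : UpEdge B → Finset (Fin a) := fun e => (F.filter fun τ => τ.1 = e).image fun τ => τ.2.1
  let f : UpEdge B → Fin a → Fin a := fun e i =>
    if h : ∃ τ ∈ F, τ.1 = e ∧ τ.2.1 = i then h.choose.2.2 else i
  have hsub : constrained F ⊆ Fintype.piFinset fun e => permsPrescribed (S e) (f e) := by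
    intro π hπ
    rw [mem_constrained] at hπ
    rw [Fintype.mem_piFinset]
    intro e
    rw [mem_permsPrescribed]
    intro i hi
    obtain ⟨τ, hτ, hτi⟩ := Finset.mem_image.1 hi
    obtain ⟨hτF, hτe⟩ := Finset.mem_filter.1 hτ
    have hex : ∃ τ ∈ F, τ.1 = e ∧ τ.2.1 = i := ⟨τ, hτF, hτe, hτi⟩
    have hspec := hex.choose_spec
    show π e i = (if h : ∃ τ ∈ F, τ.1 = e ∧ τ.2.1 = i then h.choose.2.2 else i)
    rw [dif_pos hex, ← hπ _ hspec.1, hspec.2.1, hspec.2.2]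
  -- sizes: `|S e| = m e` and `∑ m e = |F|`
  let m : UpEdge B → ℕ := fun e => (F.filter fun τ => τ.1 = e).card
  have hSm : ∀ e, (S e).card = m e := by
    intro e
    refine Finset.card_image_of_injOn fun τ hτ τ' hτ' h => ?_
    rw [Finset.mem_coe, Finset.mem_filter] at hτ hτ'
    by_contra hne
    exact hinc τ hτ.1 τ' hτ'.1 hne (hτ.2.trans hτ'.2.symm) h
  have hsum : ∑ e, m e = F.card :=
    (Finset.card_eq_sum_card_fiberwise (f := fun τ : PotEdge B a => τ.1) (t := Finset.univ)
      fun _ _ => Finset.mem_univ _).symm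
  have hmle : ∀ e, m e ≤ F.card := fun e => Finset.card_filter_le _ _
  -- the product bound
  calc (constrained F).card * (a - F.card) ^ F.card
      ≤ (∏ e, (permsPrescribed (S e) (f e)).card) * (a - F.card) ^ F.card := by
        refine Nat.mul_le_mul_right _ ((Finset.card_le_card hsub).trans ?_)
        rw [Fintype.card_piFinset]
    _ ≤ (∏ e, (a - m e).factorial) * (a - F.card) ^ (∑ e, m e) := by
        rw [hsum]
        refine Nat.mul_le_mul_right _ (Finset.prod_le_prod' fun e _ => ?_)
        have := card_permsPrescribed_le (S e) (f e)
        rwa [Fintype.card_fin, hSm e] at this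
    _ = ∏ e, ((a - m e).factorial * (a - F.card) ^ m e) := by
        rw [← Finset.prod_pow_eq_pow_sum, ← Finset.prod_mul_distrib]
    _ ≤ ∏ _e : UpEdge B, a.factorial :=
        Finset.prod_le_prod' fun e _ => factorial_sub_mul_pow_le hF (hmle e)
    _ = a.factorial ^ Fintype.card (UpEdge B) := by rw [Finset.prod_const, Finset.card_univ]

/-! ### The first-moment count -/

/-- The lifts with a `u`-set spanning at least `j` edges. [folklore] -/
def denseLifts (u j : ℕ) : Finset (UpEdge B → Equiv.Perm (Fin a)) :=
  Finset.univ.filter fun π => ∃ U : Finset (W × Fin a), U.card = u ∧ j ≤ (edgesIn (liftGraph π) U).card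

/-- Membership in `denseLifts`. [folklore] -/
theorem mem_denseLifts {u j : ℕ} {π : UpEdge B → Equiv.Perm (Fin a)} :
    π ∈ denseLifts u j ↔ ∃ U : Finset (W × Fin a), U.card = u ∧ j ≤ (edgesIn (liftGraph π) U).card := by
  simp [denseLifts]

/-- **First moment for dense small sets in random lifts**:
`#{π | ∃ U, |U| = u, e_π(U) ≥ j} · (a - j)^j ≤ C(|W|·a, u) · C(u², j) · (a!)^{|E|}` (`j ≤ a`).
[folklore] -/
theorem card_denseLifts_mul_le {u j : ℕ} (hj : j ≤ a) :
    (denseLifts (B := B) (a := a) u j).card * (a - j) ^ j ≤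
      (Fintype.card W * a).choose u * (u ^ 2).choose j * a.factorial ^ Fintype.card (UpEdge B) := by
  classical
  -- `denseLifts ⊆ ⋃_U ⋃_F constrained F`
  set Us := (Finset.univ : Finset (W × Fin a)).powersetCard u with hUs
  have hcover : denseLifts (B := B) (a := a) u j ⊆
      Us.biUnion fun U => ((PotEdge.inside U).powersetCard j).biUnion constrained := by
    intro π hπ
    obtain ⟨U, hUu, hUj⟩ := mem_denseLifts.1 hπ
    obtain ⟨F, hFsub, hFcard, hπF⟩ := exists_constrained_of_le_card_edgesIn π U hUj
    rw [Finset.mem_biUnion]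
    refine ⟨U, Finset.mem_powersetCard.2 ⟨Finset.subset_univ _, hUu⟩, ?_⟩
    rw [Finset.mem_biUnion]
    exact ⟨F, Finset.mem_powersetCard.2 ⟨hFsub, hFcard⟩, hπF⟩
  calc (denseLifts (B := B) (a := a) u j).card * (a - j) ^ j
      ≤ (Us.biUnion fun U => ((PotEdge.inside U).powersetCard j).biUnion constrained).card * (a - j) ^ j :=
        Nat.mul_le_mul_right _ (Finset.card_le_card hcover)
    _ ≤ (∑ U ∈ Us, (((PotEdge.inside U).powersetCard j).biUnion constrained).card) * (a - j) ^ j :=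
        Nat.mul_le_mul_right _ Finset.card_biUnion_le
    _ ≤ (∑ U ∈ Us, ∑ F ∈ (PotEdge.inside U).powersetCard j, (constrained F).card) * (a - j) ^ j :=
        Nat.mul_le_mul_right _ (Finset.sum_le_sum fun U _ => Finset.card_biUnion_le)
    _ = ∑ U ∈ Us, ∑ F ∈ (PotEdge.inside U).powersetCard j, (constrained F).card * (a - j) ^ j := by
        rw [Finset.sum_mul]; refine Finset.sum_congr rfl fun U _ => Finset.sum_mul _ _ _
    _ ≤ ∑ U ∈ Us, ∑ _F ∈ (PotEdge.inside U).powersetCard j, a.factorial ^ Fintype.card (UpEdge B) := by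
        refine Finset.sum_le_sum fun U _ => Finset.sum_le_sum fun F hF => ?_
        have hFc : F.card = j := (Finset.mem_powersetCard.1 hF).2
        have := card_constrained_mul_le F (hFc ▸ hj)
        rwa [hFc] at this
    _ ≤ ∑ _U ∈ Us, (u ^ 2).choose j * a.factorial ^ Fintype.card (UpEdge B) := by
        refine Finset.sum_le_sum fun U hU => ?_
        rw [Finset.sum_const, smul_eq_mul, Finset.card_powersetCard]
        refine Nat.mul_le_mul_right _ ?_
        have hUu : U.card = u := (Finset.mem_powersetCard.1 hU).2
        exact (Nat.choose_le_choose j (PotEdge.card_inside_le U)).trans (by rw [hUu])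
    _ = (Fintype.card W * a).choose u * (u ^ 2).choose j * a.factorial ^ Fintype.card (UpEdge B) := by
        rw [Finset.sum_const, smul_eq_mul, hUs, Finset.card_powersetCard, Finset.card_univ,
          Fintype.card_prod, Fintype.card_fin, mul_assoc]

end Literature.Combinatorics.SimpleGraph
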